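import Mathlib
import HarnessLib
import Summits.HubbardSuperconductivity.HubbardSuperconductivity.Theorems.KLProgrammeKLRegimeTwoVolumeGluedProfiles
import Summits.HubbardSuperconductivity.HubbardSuperconductivity.Theorems.KLProgrammeKLRegimeEngineE4ScaleDoor
import Summits.HubbardSuperconductivity.HubbardSuperconductivity.Theorems.KLProgrammeKLRegimeEngineScaleZeroE4Geometry
import Literature.MathematicalPhysics.QuantumLattice.SectorisedKernelNormRefinementPlateau

/-!
# Route `KLProgramme` — crux K3, the nested two-volume pass: BRIDGE between the engine's weighted pinned sums and the STEP's profile format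
# (cell gate-hubbard-kl, seat hubbard-kl-k3c4-p1 g9; blueprint VL-INDUCTION-BLUEPRINT-g9.md §C (T1); `--supports` stmt-…-20440)

The two-volume STEP / ScaleSucc read profiles of the form `Σ_{Y : Y j = x} ‖kernel W (2m′) Y‖ · diamWeight φ d′ (univ.image Y)` on sector-field labels
`SpaceTimeIdx L M × SectorLeg N`; the engine exports `klWtPinnedSum … n m q w = ε^{m−1} · Σ_{X : X q = w} klScaleWt_n(positions of X) · ‖kernel (map (toLin' E_n) 𝒱⁽ⁿ⁾) m X‖`
(`…EngineE4ScaleDoor`).  This file identifies the two formats: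

* `phiScale_*` — `φ_n(s) := 1 + Λ_n·s` satisfies the STEP's three weight hypotheses (`≥ 1`, monotone, sub-multiplicative on `[0,∞)`);
* `isLabelDist_pullback` / **`diamWeight_latticeLegPos_eq_klScaleWt`** — with the pulled-back grid distance `d′ a b := gridLabelDist (latticeLegPos a) (latticeLegPos b)`
  (a label pseudo-distance), `diamWeight φ_n d′ (univ.image Y) = klScaleWt L M β n ((univ.image Y).image latticeLegPos)`;
* **`sum_wt_norm_kernel_sectorPreimage_eq`** — for every family `F`, degree `m`, pin and weight,
  `Σ_{Y : Y q = w} ‖kernel (sectorPreimage β F G) m Y‖·wt(Y) = ε^m · Σ_{Y : Y q = w} ‖kernel (map (toLin' E_F) G) m Y‖·wt(Y)` (`ε = imagTimeWeight β M ≥ 0`);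
* **`sum_wt_norm_kernel_sectorPreimage_klEffectiveAction_eq`** — hence for the model at scale `n` (aniso family, any frame `K`), `m ≥ 1`:
  `Σ_{Y : Y q = w} ‖kernel (sectorPreimage β (klAnisoFamily … K klE0 n) (klEffectiveAction … K klE0 n)) m Y‖ · klScaleWt_n(positions of Y) = ε · klWtPinnedSum … K n m q w`
  — the input profile of `…TwoVolumeScaleSucc` IS `ε ×` the (E1-W) export `KernelNormsWt` (every degree, including `m = 2`).

Model-generic; everything proved; no definition.
-/

noncomputable section

namespace Summit.HubbardSuperconductivity.HubbardSuperconductivity.Theorems.TwoVolumeDefect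

set_option linter.dupNamespace false -- summit = problem name (single-conjunct summit), D-0017

open Finset Literature.MathematicalPhysics.QuantumLattice GrassmannAlgebra Literature.Probability.LatticeModels
  Literature.Probability.LatticeModels.BattleFederbush
open Summit.HubbardSuperconductivity.HubbardSuperconductivity.Theorems.KLRegimeSplit
open Summit.HubbardSuperconductivity.HubbardSuperconductivity.Theorems.KLProgrammeLegKernels
open Summit.HubbardSuperconductivity.HubbardSuperconductivity.Theorems.EngineV8

/-! ## §1 The linear scale weight `φ_n(s) = 1 + Λ_n s` -/

/-- `1 ≤ 1 + Λ s` for `Λ, s ≥ 0`. [folklore] -/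
theorem phiScale_one_le {Λ : ℝ} (hΛ : 0 ≤ Λ) (s : ℝ) (hs : 0 ≤ s) : 1 ≤ 1 + Λ * s := by nlinarith

/-- `s ↦ 1 + Λ s` is monotone for `Λ ≥ 0`. [folklore] -/
theorem phiScale_mono {Λ : ℝ} (hΛ : 0 ≤ Λ) (s t : ℝ) (_hs : 0 ≤ s) (hst : s ≤ t) : 1 + Λ * s ≤ 1 + Λ * t := by nlinarith

/-- `1 + Λ(s+t) ≤ (1 + Λ s)(1 + Λ t)` for `Λ, s, t ≥ 0`. [folklore] -/
theorem phiScale_submul {Λ : ℝ} (hΛ : 0 ≤ Λ) (s t : ℝ) (hs : 0 ≤ s) (ht : 0 ≤ t) : 1 + Λ * (s + t) ≤ (1 + Λ * s) * (1 + Λ * t) := by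
  nlinarith [mul_nonneg (mul_nonneg hΛ hs) (mul_nonneg hΛ ht)]

/-! ## §2 Pulled-back distances and the engine's weight -/

/-- **The pull-back of a label pseudo-distance along any map is a label pseudo-distance.** [folklore] -/
theorem isLabelDist_pullback {Λ Λ' : Type*} {d : Λ' → Λ' → ℝ} (hd : IsLabelDist d) (f : Λ → Λ') : IsLabelDist fun a b => d (f a) (f b) where
  self _ := hd.self _
  symm _ _ := hd.symm _ _
  nonneg _ _ := hd.nonneg _ _
  triangle _ _ _ := hd.triangle _ _ _

variable {L M : ℕ} [NeZero L] [NeZero M]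

omit [NeZero L] [NeZero M] in
/-- **The STEP's diameter weight with the pulled-back grid distance IS the engine's `klScaleWt`** on the positions of the tuple. [folklore] -/
theorem diamWeight_latticeLegPos_eq_klScaleWt {Ns : ℕ} (β : ℝ) (n : ℕ) {ι : Type*} [Fintype ι] [DecidableEq ι]
    (Y : ι → SpaceTimeIdx L M × SectorLeg Ns) :
    diamWeight (fun s => 1 + klScale klE0 n * s)
        (fun a b : SpaceTimeIdx L M × SectorLeg Ns => gridLabelDist L (2 * (2 * M)) β (latticeLegPos (2 * (2 * M)) a) (latticeLegPos (2 * (2 * M)) b))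
        (univ.image Y) =
      klScaleWt L M β n ((univ.image Y).image (latticeLegPos (2 * (2 * M)))) := by
  unfold klScaleWt
  exact (diamWeight_image_eq_of_isometry _ (fun a b : SpaceTimeIdx L M × SectorLeg Ns =>
    gridLabelDist L (2 * (2 * M)) β (latticeLegPos (2 * (2 * M)) a) (latticeLegPos (2 * (2 * M)) b)) (gridLabelDist L (2 * (2 * M)) β)
    (latticeLegPos (2 * (2 * M))) (fun _ _ => rfl) (univ.image Y)).symm

/-! ## §3 Profiles of the sector preimage = `ε^m ×` profiles of the analysed action -/

omit [NeZero M] in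
/-- **`Σ_{Y : Y q = w} ‖kernel (sectorPreimage β F G) m Y‖·wt(Y) = ε^m · Σ_{Y : Y q = w} ‖kernel (map (toLin' E_F) G) m Y‖·wt(Y)`** (`β ≥ 0`). [folklore] -/
theorem sum_wt_norm_kernel_sectorPreimage_eq {N : ℕ} {β : ℝ} (hβ : 0 ≤ β) (F : Fin N → FreqMomentum L M → ℂ) (G : HubbardGrassmann L M) (m : ℕ)
    (q : Fin m) (w : SpaceTimeIdx L M × SectorLeg N) (wt : (Fin m → SpaceTimeIdx L M × SectorLeg N) → ℝ) :
    ∑ Y ∈ univ.filter (fun Y : Fin m → SpaceTimeIdx L M × SectorLeg N => Y q = w), ‖kernel ℂ (sectorPreimage β F G) m Y‖ * wt Y =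
      imagTimeWeight β M ^ m *
        ∑ Y ∈ univ.filter (fun Y : Fin m → SpaceTimeIdx L M × SectorLeg N => Y q = w),
          ‖kernel ℂ (ExteriorAlgebra.map (Matrix.toLin' (sectorAnalysisMatrix L M β F)) G) m Y‖ * wt Y := by
  have hε : 0 ≤ imagTimeWeight β M := imagTimeWeight_nonneg hβ M
  rw [mul_sum]
  refine sum_congr rfl fun Y _ => ?_
  rw [kernel_sectorPreimage_eq_sectorisedKernel, ← kernel_map_sectorAnalysis, norm_mul, norm_pow, Complex.norm_real, Real.norm_of_nonneg hε]
  ring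

omit [NeZero M] in
/-- **THE MODEL BRIDGE**: at scale `n`, frame `K`, degree `m ≥ 1`, pin `(q, w)`:
`Σ_{Y : Y q = w} ‖kernel (sectorPreimage β (klAnisoFamily … K klE0 n) (klEffectiveAction … K klE0 n)) m Y‖ · klScaleWt_n(positions of Y) = ε · klWtPinnedSum … K n m q w`
— the `klScaleWt`-weighted profile of the sector-preimage presentation is `ε ×` the engine's (E1-W) weighted pinned sum. [folklore] -/
theorem sum_wt_norm_kernel_sectorPreimage_klEffectiveAction_eq {β : ℝ} (hβ : 0 ≤ β) (U μ : ℝ) (K : TrigPolyC4v) (n : ℕ) {m : ℕ} (hm : 1 ≤ m)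
    (q : Fin m) (w : SpaceTimeIdx L M × SectorLeg (sectorCount n)) :
    ∑ Y ∈ univ.filter (fun Y : Fin m → SpaceTimeIdx L M × SectorLeg (sectorCount n) => Y q = w),
        ‖kernel ℂ (sectorPreimage β (klAnisoFamily L M β μ K klE0 n) (klEffectiveAction L M β U μ K klE0 n)) m Y‖ *
          klScaleWt L M β n ((univ.image Y).image (latticeLegPos (2 * (2 * M)))) =
      imagTimeWeight β M * klWtPinnedSum L M β U μ K n m q w := by
  rw [sum_wt_norm_kernel_sectorPreimage_eq hβ, klWtPinnedSum_def]
  obtain ⟨k, rfl⟩ : ∃ k, m = k + 1 := ⟨m - 1, by omega⟩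
  have hs : (∑ Y ∈ univ.filter (fun Y : Fin (k + 1) → SpaceTimeIdx L M × SectorLeg (sectorCount n) => Y q = w),
        ‖kernel ℂ (ExteriorAlgebra.map (Matrix.toLin' (sectorAnalysisMatrix L M β (klAnisoFamily L M β μ K klE0 n)))
            (klEffectiveAction L M β U μ K klE0 n)) (k + 1) Y‖ * klScaleWt L M β n ((univ.image Y).image (latticeLegPos (2 * (2 * M))))) =
      ∑ Y ∈ univ.filter (fun Y : Fin (k + 1) → SpaceTimeIdx L M × SectorLeg (sectorCount n) => Y q = w),
        klScaleWt L M β n ((univ.image Y).image (latticeLegPos (2 * (2 * M)))) *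
          ‖kernel ℂ (ExteriorAlgebra.map (Matrix.toLin' (sectorAnalysisMatrix L M β (klAnisoFamily L M β μ K klE0 n)))
            (klEffectiveAction L M β U μ K klE0 n)) (k + 1) Y‖ := sum_congr rfl fun Y _ => mul_comm _ _
  rw [hs, Nat.add_sub_cancel, pow_succ]
  ring

end Summit.HubbardSuperconductivity.HubbardSuperconductivity.Theorems.TwoVolumeDefect

end
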